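import Mathlib
import Summits.Ventures.HodgeRepro2.HeckeEigenformsUnconditional

/-!
# HolomorphicSpaceNontrivial — `S_3(Γ') ≠ 0`: the Tier-3 input gives a congruence subgroup whose
space of holomorphic weight-`3` forms is finite-dimensional of POSITIVE dimension

Blind cell `pub-hodge-repro2`, seat p2 (Tier 5 kernel support).

Combining the vertex form of `NonVanishingHeckeEigenform.lean` (a holomorphic weight-`3` form
`f ≢ 0` for a torsion-free congruence subgroup `S' ⊆ Γ_N`) with the finite-dimensionality of
`HolomorphicFiniteDimensional.lean`:

* **`NonVanishingInput.exists_finrank_holomorphicSpace_pos`**: there is such an `S'` (compact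
  quotient, measurable fundamental domain `D`) with `holomorphicSpace` finite-dimensional and
  `0 < finrank ℂ (holomorphicSpace …)` — the kernel form of «the Picard modular surface
  `S'\𝔹²` carries a non-zero holomorphic weight-`3` form».
-/

namespace Summit.Ventures.HodgeRepro2.ShimuraData

open MeasureTheory

variable {K : Type*} [Field K] [NumberField K] [NumberField.IsCMField K] {τ₁ : K →+* ℂ}
  {H : Matrix (Fin 3) (Fin 3) K} {Q : Matrix (Fin 3) (Fin 3) ℂ} {𝔪 : Submodule ℤ (Fin 3 → K)}

/-- **`S_3(Γ') ≠ 0` from the Tier-3 input**: a torsion-free congruence subgroup `S' ⊆ Γ_N` of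
finite index in `Γ_1` with compact quotient and a measurable fundamental domain `D` such that the
holomorphic part of the weight-`3` Petersson space is finite-dimensional of positive dimension. -/
theorem NonVanishingInput.exists_finrank_holomorphicSpace_pos (hH : IsHermitianForm K H)
    (hdef : ∀ τ : K →+* ℂ, NumberField.InfinitePlace.mk τ ≠ NumberField.InfinitePlace.mk τ₁ →
      IsDefiniteAt K τ H)
    (hQ : IsFrame K τ₁ H Q) (h𝔪 : IsLattice K 𝔪) (hnv : NonVanishingInput K τ₁ H 𝔪 Q) {N : ℕ}
    (hN : 2 < N)
    [CompactSpace (ballQuotient hQ (shimuraLevelSubgroup K H 𝔪 1)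
      (shimuraLevelSubgroup_one_subset_unitaryGroup H 𝔪))] :
    ∃ S' : Subgroup (GL (Fin 3) K), ∃ hS' : (S' : Set (GL (Fin 3) K)) ⊆ shimuraLevel K H 𝔪 N,
      IsTorsionFreeSet K (S' : Set (GL (Fin 3) K)) ∧
      S' ≤ shimuraLevelSubgroup K H 𝔪 1 ∧
      (S'.subgroupOf (shimuraLevelSubgroup K H 𝔪 1)).FiniteIndex ∧
      ∃ _hc : CompactSpace (ballQuotient hQ S' (subset_unitaryGroup_of_subset_shimuraLevel hS')),
      ∃ D : Set ball₂, MeasurableSet D ∧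
      ∃ hD : IsBallFundamentalDomain hQ S' (subset_unitaryGroup_of_subset_shimuraLevel hS') D,
        FiniteDimensional ℂ (holomorphicSpace hQ S' _ 3 hD) ∧
        0 < Module.finrank ℂ (holomorphicSpace hQ S' _ 3 hD) := by
  obtain ⟨S', hS', htf, hS₁, hfin, hc, D, hDm, hD, f, hfhol, hfne, -⟩ :=
    hnv.exists_hecke_eigenform hH hdef hQ h𝔪 hN
  haveI := hc
  haveI hfd : FiniteDimensional ℂ
      (holomorphicSpace hQ S' (subset_unitaryGroup_of_subset_shimuraLevel hS') 3 hD) :=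
    finiteDimensional_holomorphicSpace hQ S' _ 3 hD
      (properlyDiscontinuousSMul_frameAction hH hdef hQ h𝔪 hS')
  refine ⟨S', hS', htf, hS₁, hfin, hc, D, hDm, hD, hfd, ?_⟩
  rw [Module.finrank_pos_iff_exists_ne_zero]
  refine ⟨⟨SeparationQuotient.mk f, mk_mem_holomorphicSpace hQ S' _ 3 hD hfhol⟩, ?_⟩
  intro h
  apply hfne
  have := congrArg Subtype.val h
  simpa using this

end Summit.Ventures.HodgeRepro2.ShimuraData
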